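import Literature.Topology.FourManifolds.HCobordismLevelConnectivityProofs
import Literature.Topology.FourManifolds.HCobordismMiddleStepProofs
import HarnessLib

/-!
# Wall 1964, Lemma 2, Morse-theoretic route: the level above the homological 2-handles and the
# top part are simply connected

Topic `Literature/Topology/FourManifolds` (fact seat
`provefact-Literature.Topology.FourManifolds.exists-68ee520c9a`, Wall 1964, Lemma 2,
`WallBoundingHandlebody.lean`; the `π₁` half of item 5 of the route recorded there: *"The level
`L` and `C` are simply connected (van Kampen through the handles: parts (1) and (3) of
`Cobordism.Milnor1965_simplyConnected_levels_holds`, to be re-derived for `K`, which is not an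
h-cobordism)"*).  Everything here is **proved**; no named facts.

For a Morse function `g` on a 5-dimensional cobordism `(K; V, P)` with `V` simply connected,
all critical points of index `≥ 2`, and a non-critical level `m` below which all critical
points have index `2` (the output of `WallHandlebodyProgram.lean`):

* `Cobordism.IsMorseFunction.isSimplyConnected_level_of_index_two_below` — **the level
  `L = g⁻¹(m)` is simply connected**: `g⁻¹[0, m]` is `inl(V)` with cells of dimension `2`
  attached, so it is simply connected (Milnor 1965, PDF p. 56 via Thm. 3.14; the tree's
  `Cobordism.isSimplyConnected_slab_left`, part 1, from the degenerate slab `g⁻¹[0, 0] = inl V`);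
  turning the triad about, `g⁻¹[0, m] = (1 - g)⁻¹[1 - m, 1]` is also `g⁻¹(m)` with cells of
  dimension `5 - 2 = 3` attached, so `g⁻¹(m)` is simply connected (part 2 of the same theorem,
  Remark 1 after Thm. 6.4).  This is Wall's "since the codimension of a disc `Dᵢ²` is 3, `C` is
  also simply-connected" for the boundary `∂H` of the handlebody.
* `Cobordism.IsMorseFunction.isSimplyConnected_slab_of_index_two_below` — **the top part
  `C = g⁻¹[m, b]` is simply connected** for every non-critical `b ∈ (m, 1)`: a slab over the
  simply connected level `g⁻¹(m)` with critical points of index `≥ 2` (the tree's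
  `isSimplyConnected_slab_of_level`, Milnor's "`c_p c_q` is simply connected", PDF p. 53).

## References

* C. T. C. Wall, *On simply-connected 4-manifolds*, J. London Math. Soc. 39 (1964), proof of
  Lemma 2 (p. 144). [WallJLMS1964]
* J. Milnor, *Lectures on the h-cobordism theorem* (1965), Thm. 3.14 (PDF pp. 19–21),
  Remark 1 after Thm. 6.4 (PDF p. 38), proof of Thm. 7.8 (PDF p. 53), proof of Thm. 8.1
  (PDF p. 56). [MilnorHCobordism1965]
-/

open scoped Manifold ContDiff Topology
open Set Function

noncomputable section

universe u

namespace Literature.Topology.FourManifolds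

/-- Local notation: `𝔼 n` is the model Euclidean space `EuclideanSpace ℝ (Fin n)`. -/
local notation "𝔼 " n:arg => EuclideanSpace ℝ (Fin n)

variable {V P : Type u} [TopologicalSpace V] [T2Space V] [SecondCountableTopology V]
  [ChartedSpace (𝔼 4) V] [IsManifold (𝓡 4) ∞ V] [CompactSpace V]
  [TopologicalSpace P] [T2Space P] [SecondCountableTopology P] [ChartedSpace (𝔼 4) P]
  [IsManifold (𝓡 4) ∞ P] [CompactSpace P]

omit [T2Space V] [SecondCountableTopology V] [IsManifold (𝓡 4) ∞ V] [CompactSpace V] [T2Space P]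
  [SecondCountableTopology P] [IsManifold (𝓡 4) ∞ P] [CompactSpace P] in
/-- The incoming end `inl(V) = g⁻¹[0, 0]` of a cobordism with simply connected `V` is simply
connected. [folklore] -/
theorem Cobordism.IsMorseFunction.isSimplyConnected_preimage_Icc_zero_zero {d : Cobordism 4 V P}
    {g : d.W → ℝ} (hg : d.IsMorseFunction g) [SimplyConnectedSpace V] :
    IsSimplyConnected (g ⁻¹' Icc (0 : ℝ) 0) := by
  have h1 : g ⁻¹' Icc (0 : ℝ) 0 = range d.inl := by
    rw [← hg.preimage_zero]
    ext z; simp only [mem_preimage, mem_singleton_iff]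
    exact ⟨fun h => le_antisymm h.2 h.1, fun h => ⟨h.ge, h.le⟩⟩
  rw [h1, ← image_univ, d.isSmoothEmbedding_inl.isEmbedding.isSimplyConnected_image]
  exact (Homeomorph.Set.univ V).toHomotopyEquiv.simplyConnectedSpace_iff.2 inferInstance

/-- **The level above the index-2 handles is simply connected** (Wall 1964, proof of Lemma 2:
`∂H` is simply connected; Milnor 1965, PDF p. 56 and Remark 1 p. 38 via Thm. 3.14, twice).
For a Morse function `g` on a 5-dimensional cobordism `(K; V, P)` with `V` simply connected
and a non-critical `m ∈ (0, 1)` below which every critical point has index `2`: `g⁻¹(m)` is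
simply connected. [cite: MilnorHCobordism1965, proof of Thm. 8.1 (PDF p. 56) and Remark 1 after Thm. 6.4 (PDF p. 38), with Thm. 3.14] [cite: WallJLMS1964, proof of Lemma 2 (p. 144)] -/
theorem Cobordism.IsMorseFunction.isSimplyConnected_level_of_index_two_below {d : Cobordism 4 V P}
    {g : d.W → ℝ} (hg : d.IsMorseFunction g) [SimplyConnectedSpace V] {m : ℝ} (hm : m ∈ Ioo (0 : ℝ) 1)
    (hreg : ∀ z ∈ criticalSet (𝓡∂ (4 + 1)) g, g z ≠ m)
    (hidx : ∀ z ∈ criticalSet (𝓡∂ (4 + 1)) g, g z < m → morseIndex (𝓡∂ (4 + 1)) g z = 2) :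
    IsSimplyConnected (g ⁻¹' {m}) := by
  obtain ⟨ξ, hξ⟩ := Cobordism.Milnor1965_exists_isGradientLike_holds (c := d) hg
  -- `g⁻¹[0, m]` is simply connected: `inl V` with 2-cells attached
  have hreg0 : ∀ z ∈ criticalSet (𝓡∂ (4 + 1)) g, g z ≠ 0 ∧ g z ≠ m := fun z hz =>
    ⟨(hg.apply_mem_Ioo_of_mem_criticalSet hz).1.ne', hreg z hz⟩
  have h0m : IsSimplyConnected (g ⁻¹' Icc (0 : ℝ) m) :=
    (Cobordism.isSimplyConnected_slab_left Cobordism.Milnor1965_deformationRetract_leftHandDiscs_holds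
      Cobordism.Milnor1965_leftHandDisc_isDisc_holds hg ξ hξ le_rfl le_rfl hm.1 hm.2.le hreg0).1
      (fun z hz hzI => (hidx z hz hzI.2).ge) hg.isSimplyConnected_preimage_Icc_zero_zero
  -- turning about: `g⁻¹[0, m] = (1 - g)⁻¹[1 - m, 1]` is `g⁻¹(m)` with 3-cells attached
  have hg' : d.symm.IsMorseFunction (fun z => 1 - g z) := hg.symm
  have hξ' : IsGradientLike (𝓡∂ (4 + 1)) (fun z => 1 - g z) (⇑(-ξ)) := by
    rw [ContMDiffSection.coe_neg]
    exact hg.isGradientLike_const_sub_neg hξ 1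
  have hcrit' := hg.criticalSet_one_sub
  have hset : (fun z : d.W => 1 - g z) ⁻¹' Icc (1 - m) 1 = g ⁻¹' Icc (0 : ℝ) m := by
    ext z; simp only [mem_preimage]; constructor <;> rintro ⟨h1, h2⟩ <;> constructor <;> linarith
  have hlev : (fun z : d.W => 1 - g z) ⁻¹' Icc (1 - m) (1 - m) = g ⁻¹' {m} := by
    ext z; simp only [mem_preimage, mem_singleton_iff]
    constructor
    · rintro ⟨h1, h2⟩; linarith
    · intro h; constructor <;> linarith
  have h0m' : IsSimplyConnected ((fun z : d.W => 1 - g z) ⁻¹' Icc (1 - m) 1) := by rw [hset]; exact h0m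
  have hreg' : ∀ z ∈ criticalSet (𝓡∂ (4 + 1)) (fun z => 1 - g z), 1 - g z ≠ 1 - m ∧ 1 - g z ≠ 1 := by
    intro z hz
    have hz : z ∈ criticalSet (𝓡∂ (4 + 1)) g := (Set.ext_iff.1 hcrit' z).1 hz
    refine ⟨fun h => hreg z hz (by linarith), fun h => ?_⟩
    exact (hg.apply_mem_Ioo_of_mem_criticalSet hz).1.ne' (by linarith)
  have key := (Cobordism.isSimplyConnected_slab_left
    Cobordism.Milnor1965_deformationRetract_leftHandDiscs_holds
    Cobordism.Milnor1965_leftHandDisc_isDisc_holds hg' (-ξ) hξ' (a := 1 - m) (t := 1 - m) (b := 1)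
    (by linarith [hm.2]) le_rfl (by linarith [hm.1]) le_rfl hreg').2
    (fun z hz hzI => by
      have hz : z ∈ criticalSet (𝓡∂ (4 + 1)) g := (Set.ext_iff.1 hcrit' z).1 hz
      have hlt : g z < m := by linarith [hzI.1]
      have hsum : morseIndex (𝓡∂ (4 + 1)) (fun z : d.W => 1 - g z) z +
          morseIndex (𝓡∂ (4 + 1)) g z = 4 + 1 := hg.morseIndex_one_sub_add hz
      have h2 := hidx z hz hlt
      show 3 ≤ morseIndex (𝓡∂ (4 + 1)) (fun z : d.W => 1 - g z) z
      omega)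
    h0m'
  have key' : IsSimplyConnected ((fun z : d.W => 1 - g z) ⁻¹' Icc (1 - m) (1 - m)) := key
  rwa [hlev] at key'

/-- **The top part `C = g⁻¹[m, b]` is simply connected** (a slab over the simply connected level
`g⁻¹(m)` all of whose critical points have index `≥ 2`; the tree's
`isSimplyConnected_slab_of_level`, Milnor 1965, PDF p. 53). [cite: MilnorHCobordism1965, proof of Thm. 7.8 (PDF p. 53) and Remark 1 after Thm. 6.4 (PDF p. 38)] [cite: WallJLMS1964, proof of Lemma 2 (p. 144: "C is also simply-connected")] -/
theorem Cobordism.IsMorseFunction.isSimplyConnected_slab_of_index_two_below {d : Cobordism 4 V P}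
    {g : d.W → ℝ} (hg : d.IsMorseFunction g) [SimplyConnectedSpace V] {m b : ℝ} (hm : m ∈ Ioo (0 : ℝ) 1)
    (hmb : m < b) (hb1 : b < 1)
    (hreg : ∀ z ∈ criticalSet (𝓡∂ (4 + 1)) g, g z ≠ m ∧ g z ≠ b)
    (h2 : ∀ z ∈ criticalSet (𝓡∂ (4 + 1)) g, 2 ≤ morseIndex (𝓡∂ (4 + 1)) g z)
    (hidx : ∀ z ∈ criticalSet (𝓡∂ (4 + 1)) g, g z < m → morseIndex (𝓡∂ (4 + 1)) g z = 2) :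
    IsSimplyConnected (g ⁻¹' Icc m b) :=
  isSimplyConnected_slab_of_level hg hm.1 hmb hb1 hreg
    (hg.isSimplyConnected_level_of_index_two_below hm (fun z hz => (hreg z hz).1) hidx)
    (fun z hz _ => h2 z hz)

end Literature.Topology.FourManifolds
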